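import Literature.MathematicalPhysics.QuantumManyBody.LiebYngvasonTheorem
import HarnessLib

/-!
# Route `BECRichardsonGaudin`, crux `BeliaevDeformationBound` (stmt-AtomisticToContinuum-14804):
# complete condensation of the shifted (penalised) gas — stub B2 of the line `registered`

This file proves the registered stub `stub_penalisedCondensation` (B2) of the skeleton
`Cruxes/BeliaevDeformationBound/Lines/birth.lean` (v2) of the line `registered`, supporting (not
closing) stmt-AtomisticToContinuum-14804.

For a soft repulsive finite-range pair potential `v` (`γ = ∫ v(|x|) dx ∈ (0, ∞)`), density `ρ`,
`N = n + 2` bosons on the torus of side `L = (N/ρ)^{1/3}` and the SHIFTED (penalised) energy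
`E_pen(Ψ) = ⟨Ψ, HΨ⟩ + 2ργ · (N - n₀(Ψ))`, we prove: GIVEN condensed near-optimal trial states
(statement B1c of the skeleton, taken as the hypothesis `hCT`: for every `η > 0`, at small `ρ`,
eventually in `N`, some periodic trial state `Φ` has `⟨Φ, HΦ⟩ ≤ 4πaρ(1+η)N` and
`N ≤ n₀(Φ) + ηN`), the `δ`-near-minimisers `Ψ` of `E_pen` are completely condensed,
`n₀(Ψ) ≥ (1-ε)N`, at small `ρ`, eventually in `N`, for `δ = ργε/4`.

The mechanism is the Lee–Yang energy sandwich: with `E₀ = inf ⟨·, H·⟩ ≤ ⟨Ψ, HΨ⟩`,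
`2ργ · (N - n₀Ψ) ≤ E_pen(Φ) + δ - E₀ ≤ 4πaρ(1+η)N + 2ργ · ηN + δ - 4πaρ(1-η)N`
by the Lieb–Yngvason lower bound [LSSY2005, Thm. 2.4 (2.35)] (tree theorem
`LSSY2005_lowerBound_periodic_holds`, applied on the torus of side `L → ∞` at fixed `ρ`, where its
side condition `L/a > C' Y^{-6/17}` holds eventually and `C Y^{1/17} ≤ η` for small `ρ`), and
`8πa ≤ γ` by the Spruch–Rosenberg inequality [LSSY2005, App. C (C.10)] (tree theorem
`four_pi_mul_scatteringLength_le`); with `η = ε/4` this gives `N - n₀Ψ ≤ εN`.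

Contents: `penalisedCondensation_tendsto_sideLength` (`(N/ρ)^{1/3} → ∞`),
`penalisedCondensation_lowerBound_eventually` (Thm. 2.4 in the thermodynamic-limit form
`E₀ ≥ 4πaρ(1-ε)N` at small `ρ`, eventually in `N`), `penalisedCondensation_sandwich` and
`penalisedCondensation_depletion_le` (the order-theoretic and the `ℝ≥0∞ → ℝ` halves of the
sandwich), `penalisedCondensation_real_ineq` (the bookkeeping of constants), and the stub
`stub_penalisedCondensation` (statement verbatim from the skeleton).

References: LSSY2005 Thm. 2.4 (2.35), App. C (C.10), §1.2 (1.17)–(1.19), Ch. 5 (5.17);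
Lieb–Yngvason 1998; the line card `Cruxes/BeliaevDeformationBound/Lines/birth.md`.
-/

noncomputable section

namespace Summit.AtomisticToContinuum.BoseEinsteinCondensation.Theorems.BeliaevDeformationBound

open scoped ENNReal
open MeasureTheory Filter
open Literature.MathematicalPhysics.QuantumManyBody.BoseGas

/-- The side `L = (N/ρ)^{1/3}` of the torus holding `N = n + 2` particles at density `ρ > 0` tends
to infinity with `n`. [cite: LSSY2005, §1.2 (after (1.19))] -/
theorem penalisedCondensation_tendsto_sideLength {ρ : ℝ} (hρ : 0 < ρ) :
    Tendsto (fun n : ℕ => sideLength ρ (n + 2)) atTop atTop := by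
  unfold sideLength
  exact (tendsto_rpow_atTop (by norm_num : (0 : ℝ) < 1 / 3)).comp
    (((tendsto_natCast_atTop_atTop (R := ℝ)).comp (tendsto_add_atTop_nat 2)).atTop_div_const hρ)

/-- **The Lieb–Yngvason lower bound in the thermodynamic-limit form.** For a repulsive finite-range
`v` with finite scattering length `a` and every `ε > 0` there is `ρ₀ > 0` such that for
`0 < ρ < ρ₀`, eventually in `N = n + 2`, the periodic ground-state energy on the torus of side
`(N/ρ)^{1/3}` is at least `4πaρ(1-ε)N`: Theorem 2.4, `E₀ ≥ 4πρa(1 - CY^{1/17})N` for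
`Y = 4πρa³/3 < δ` and `L/a > C'Y^{-6/17}`, with `ρ` so small that `CY^{1/17} ≤ ε` and `n` so large
that the side condition holds (`L → ∞`); for `a = 0` the bound is `0 ≤ E₀`.
[cite: LSSY2005, Thm. 2.4 (2.35)] -/
theorem penalisedCondensation_lowerBound_eventually (v : ℝ → ℝ≥0∞) (hv : IsRepulsiveFiniteRange v)
    (ha : scatteringLength v ≠ ⊤) {ε : ℝ} (hε : 0 < ε) :
    ∃ ρ₀ : ℝ, 0 < ρ₀ ∧ ∀ ρ : ℝ, 0 < ρ → ρ < ρ₀ → ∀ᶠ n : ℕ in atTop,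
      ENNReal.ofReal (4 * Real.pi * (scatteringLength v).toReal * ρ * (1 - ε) * ((n + 2 : ℕ) : ℝ)) ≤
        periodicGroundStateEnergy v (n + 2) (sideLength ρ (n + 2)) := by
  obtain ⟨δL, C, C', hδL, hC, hC', H⟩ := LSSY2005_lowerBound_periodic_holds v hv ha
  dsimp only at H
  have ha_nn : 0 ≤ (scatteringLength v).toReal := ENNReal.toReal_nonneg
  rcases ha_nn.eq_or_lt with ha0 | ha0
  · -- zero scattering length: the bound reads `0 ≤ E₀`
    refine ⟨1, one_pos, fun ρ _ _ => Filter.Eventually.of_forall fun n => ?_⟩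
    rw [← ha0]
    simp
  · -- positive scattering length: Theorem 2.4 on the torus of side `(N/ρ)^{1/3} → ∞`
    generalize hα : (scatteringLength v).toReal = a at ha0 H ⊢
    obtain ⟨κ, hκ_def⟩ : ∃ κ : ℝ, κ = 4 * Real.pi * a ^ 3 / 3 := ⟨_, rfl⟩
    have hκ : 0 < κ := by rw [hκ_def]; positivity
    obtain ⟨t, ht_def⟩ : ∃ t : ℝ, t = (ε / C) ^ (17 : ℝ) := ⟨_, rfl⟩
    have ht : 0 < t := by rw [ht_def]; exact Real.rpow_pos_of_pos (div_pos hε hC) _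
    refine ⟨min (δL / κ) (t / κ), lt_min (div_pos hδL hκ) (div_pos ht hκ), fun ρ hρ hρlt => ?_⟩
    have hY : 4 * Real.pi * ρ * a ^ 3 / 3 = κ * ρ := by rw [hκ_def]; ring
    have hYδ : κ * ρ < δL := by
      rw [mul_comm]; exact (lt_div_iff₀ hκ).mp (hρlt.trans_le (min_le_left _ _))
    have hYt : κ * ρ < t := by
      rw [mul_comm]; exact (lt_div_iff₀ hκ).mp (hρlt.trans_le (min_le_right _ _))
    have hY0 : 0 ≤ κ * ρ := by positivity
    have hY17 : C * (κ * ρ) ^ ((1 : ℝ) / 17) ≤ ε := by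
      have h1 : (κ * ρ) ^ ((1 : ℝ) / 17) ≤ t ^ ((1 : ℝ) / 17) :=
        Real.rpow_le_rpow hY0 hYt.le (by norm_num)
      have h2 : t ^ ((1 : ℝ) / 17) = ε / C := by
        rw [ht_def, ← Real.rpow_mul (div_pos hε hC).le]
        norm_num
      rw [h2] at h1
      calc C * (κ * ρ) ^ ((1 : ℝ) / 17) ≤ C * (ε / C) := mul_le_mul_of_nonneg_left h1 hC.le
        _ = ε := by field_simp
    have hev : ∀ᶠ n : ℕ in atTop, C' * (κ * ρ) ^ (-(6 : ℝ) / 17) * a < sideLength ρ (n + 2) :=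
      (penalisedCondensation_tendsto_sideLength hρ).eventually_gt_atTop _
    filter_upwards [hev] with n hn
    have hN : 0 < n + 2 := Nat.succ_pos _
    have hL : 0 < sideLength ρ (n + 2) := by
      unfold sideLength
      exact Real.rpow_pos_of_pos (div_pos (by exact_mod_cast hN) hρ) _
    have h := H (n + 2) (sideLength ρ (n + 2)) hL
    rw [div_sideLength_pow_three hρ hN, hY] at h
    refine le_trans (ENNReal.ofReal_le_ofReal ?_) (h hYδ ((lt_div_iff₀ ha0).mpr hn))
    have h4 : 0 ≤ 4 * Real.pi * ρ * a * ((n + 2 : ℕ) : ℝ) := by positivity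
    calc 4 * Real.pi * a * ρ * (1 - ε) * ((n + 2 : ℕ) : ℝ)
        = 4 * Real.pi * ρ * a * ((n + 2 : ℕ) : ℝ) * (1 - ε) := by ring
      _ ≤ 4 * Real.pi * ρ * a * ((n + 2 : ℕ) : ℝ) * (1 - C * (κ * ρ) ^ ((1 : ℝ) / 17)) :=
          mul_le_mul_of_nonneg_left (by linarith) h4
      _ = 4 * Real.pi * ρ * a * (1 - C * (κ * ρ) ^ ((1 : ℝ) / 17)) * ((n + 2 : ℕ) : ℝ) := by ring

/-- **The sandwich, order-theoretic half.** For functionals `E, D ≥ 0` and a penalty weight `P`, if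
`Ψ` is a `δ`-near-minimiser of `E + P·D`, `lo ≤ E Ψ` is a finite lower bound and `Φ` is a
competitor with `E Φ ≤ hiE`, `D Φ ≤ hiD`, then `P · D Ψ ≤ hiE + P·hiD + δ - lo`. [folklore] -/
theorem penalisedCondensation_sandwich {ι : Type*} (E D : ι → ℝ≥0∞) {P lo hiE hiD δ : ℝ≥0∞}
    {Ψ Φ : ι} (hΨ : E Ψ + P * D Ψ ≤ (⨅ Ψ', (E Ψ' + P * D Ψ')) + δ) (hlo : lo ≤ E Ψ)
    (hlo' : lo ≠ ⊤) (hΦE : E Φ ≤ hiE) (hΦD : D Φ ≤ hiD) :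
    P * D Ψ ≤ hiE + P * hiD + δ - lo := by
  refine ENNReal.le_sub_of_add_le_left hlo' ?_
  calc lo + P * D Ψ ≤ E Ψ + P * D Ψ := add_le_add hlo le_rfl
    _ ≤ (⨅ Ψ', (E Ψ' + P * D Ψ')) + δ := hΨ
    _ ≤ E Φ + P * D Φ + δ := add_le_add (iInf_le (fun Ψ' => E Ψ' + P * D Ψ') Φ) le_rfl
    _ ≤ hiE + P * hiD + δ := by gcongr

/-- **The sandwich, `ℝ≥0∞ → ℝ` half.** If `p · D ≤ A₂ + p·d + δ - A₁` in `ℝ≥0∞` with real data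
`p > 0`, `A₁, A₂, d, δ ≥ 0`, and `A₂ + p d + δ - A₁ ≤ p t` in `ℝ`, then `D ≤ t`. [folklore] -/
theorem penalisedCondensation_depletion_le {D : ℝ≥0∞} {p A₁ A₂ d δr t : ℝ} (hp : 0 < p)
    (hA₁ : 0 ≤ A₁) (hA₂ : 0 ≤ A₂) (hd : 0 ≤ d) (hδ : 0 ≤ δr)
    (h : ENNReal.ofReal p * D ≤ ENNReal.ofReal A₂ + ENNReal.ofReal p * ENNReal.ofReal d +
      ENNReal.ofReal δr - ENNReal.ofReal A₁)
    (hR : A₂ + p * d + δr - A₁ ≤ p * t) : D ≤ ENNReal.ofReal t := by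
  rw [← ENNReal.ofReal_mul hp.le, ← ENNReal.ofReal_add hA₂ (by positivity),
    ← ENNReal.ofReal_add (by positivity) hδ, ← ENNReal.ofReal_sub _ hA₁] at h
  have h' : D ≤ ENNReal.ofReal (A₂ + p * d + δr - A₁) / ENNReal.ofReal p := by
    rw [ENNReal.le_div_iff_mul_le (Or.inl (ENNReal.ofReal_pos.mpr hp).ne')
      (Or.inl ENNReal.ofReal_ne_top), mul_comm]
    exact h
  refine h'.trans ?_
  rw [← ENNReal.ofReal_div_of_pos hp]
  exact ENNReal.ofReal_le_ofReal ((div_le_iff₀ hp).mpr (by linarith))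

/-- **Bookkeeping of constants.** With `8πa ≤ γ` (Spruch–Rosenberg), `η = ε/4` and slack
`δ = ργε/4`: `4πaρ(1+η)N + 2ργ·ηN + δ - 4πaρ(1-η)N ≤ 2ργ · εN` for `N ≥ 2`. [folklore] -/
theorem penalisedCondensation_real_ineq {a γ ρ ε N : ℝ} (hγ : 0 < γ)
    (h8a : 8 * Real.pi * a ≤ γ) (hρ : 0 < ρ) (hε : 0 < ε) (hN : 2 ≤ N) :
    4 * Real.pi * a * ρ * (1 + ε / 4) * N + 2 * ρ * γ * (ε / 4 * N) + ρ * γ * ε / 4 -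
        4 * Real.pi * a * ρ * (1 - ε / 4) * N ≤ 2 * ρ * γ * (ε * N) := by
  have h1 : 8 * Real.pi * a * (ρ * ε * N) ≤ γ * (ρ * ε * N) :=
    mul_le_mul_of_nonneg_right h8a (by positivity)
  have h3 : ρ * γ * ε ≤ ρ * γ * ε * N := le_mul_of_one_le_right (by positivity) (by linarith)
  have h4 : 0 < ρ * γ * ε * N := by positivity
  linarith

/-- **Stub B2 — complete condensation of the shifted gas** (registered stub
`stub_penalisedCondensation` of the line `registered`, statement verbatim). Assuming the condensed
near-optimal trial states of statement B1c (the hypothesis), for every soft repulsive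
finite-range `v` with `∫ v ≠ 0` and every `ε > 0`: at small `ρ`, eventually in `N = n + 2`, with
`δ = ργε/4`, every periodic trial state `Ψ` on the torus of side `(N/ρ)^{1/3}` with
`E_pen(Ψ) ≤ inf E_pen + δ`, `E_pen = ⟨·, H·⟩ + 2ρ(∫v)·(N - n₀)`, has `n₀(Ψ) ≥ (1-ε)N`. Proof: the
Lee–Yang sandwich `2ργ(N - n₀Ψ) ≤ E_pen(Φ) + δ - E₀` with the Lieb–Yngvason lower bound
`E₀ ≥ 4πaρ(1-ε/4)N` (Thm. 2.4, eventually in `N` at small `ρ`), the trial state `Φ` of B1c at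
`η = ε/4`, and `8πa ≤ ∫v` (Spruch–Rosenberg, (C.10)).
[cite: LSSY2005, Thm. 2.4 (2.35); App. C (C.10); Ch. 5 (5.17)] -/
theorem stub_penalisedCondensation :
  (∀ (v : ℝ → ENNReal), IsRepulsiveFiniteRange v → (∫⁻ x : Space, v ‖x‖) ≠ ⊤ → ∀ η : ℝ, 0 < η →
    ∃ ρ₀ : ℝ, 0 < ρ₀ ∧ ∀ ρ : ℝ, 0 < ρ → ρ < ρ₀ → ∀ᶠ n : ℕ in Filter.atTop,
      ∃ Φ : PeriodicTrialState (n + 2) (sideLength ρ (n + 2)),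
        periodicEnergy v Φ ≤
            ENNReal.ofReal (4 * Real.pi * (scatteringLength v).toReal * ρ * (1 + η) * ((n + 2 : ℕ) : ℝ)) ∧
          ((n + 2 : ℕ) : ENNReal) ≤ condensateOccupation (n + 2) (sideLength ρ (n + 2)) Φ.ψ +
            ENNReal.ofReal (η * ((n + 2 : ℕ) : ℝ))) →
  ∀ (v : ℝ → ENNReal), IsRepulsiveFiniteRange v → (∫⁻ x : Space, v ‖x‖) ≠ ⊤ →
    (∫⁻ x : Space, v ‖x‖) ≠ 0 → ∀ ε : ℝ, 0 < ε →
    ∃ ρ₀ : ℝ, 0 < ρ₀ ∧ ∀ ρ : ℝ, 0 < ρ → ρ < ρ₀ → ∀ᶠ n : ℕ in Filter.atTop,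
      ∃ δ : ENNReal, 0 < δ ∧ ∀ Ψ : PeriodicTrialState (n + 2) (sideLength ρ (n + 2)),
        periodicEnergy v Ψ + ENNReal.ofReal (2 * ρ * (∫⁻ x : Space, v ‖x‖).toReal) *
            (((n + 2 : ℕ) : ENNReal) - condensateOccupation (n + 2) (sideLength ρ (n + 2)) Ψ.ψ) ≤
          (⨅ Ψ' : PeriodicTrialState (n + 2) (sideLength ρ (n + 2)),
            (periodicEnergy v Ψ' + ENNReal.ofReal (2 * ρ * (∫⁻ x : Space, v ‖x‖).toReal) *
              (((n + 2 : ℕ) : ENNReal) - condensateOccupation (n + 2) (sideLength ρ (n + 2)) Ψ'.ψ))) + δ →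
        ENNReal.ofReal ((1 - ε) * ((n + 2 : ℕ) : ℝ)) ≤ condensateOccupation (n + 2) (sideLength ρ (n + 2)) Ψ.ψ := by
  intro hCT v hv hint h0 ε hε
  -- for `ε > 1` the conclusion is `0 ≤ n₀`
  rcases le_or_gt ε 1 with hε1 | hε1
  swap
  · refine ⟨1, one_pos, fun ρ _ _ => Filter.Eventually.of_forall fun n =>
      ⟨1, one_pos, fun Ψ _ => ?_⟩⟩
    rw [ENNReal.ofReal_of_nonpos (mul_nonpos_iff.2 (Or.inr ⟨by linarith, Nat.cast_nonneg _⟩))]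
    exact bot_le
  -- the constants: `γ = ∫ v > 0`, `a < ∞`, `8πa ≤ γ`
  have hγ : 0 < (∫⁻ x : Space, v ‖x‖).toReal := ENNReal.toReal_pos h0 hint
  have h2int : (∫⁻ x : Space, 2⁻¹ * v ‖x‖) = 2⁻¹ * ∫⁻ x : Space, v ‖x‖ :=
    lintegral_const_mul' _ _ (by simp)
  have h2top : 2⁻¹ * (∫⁻ x : Space, v ‖x‖) ≠ ⊤ := ENNReal.mul_ne_top (by simp) hint
  have ha_top : scatteringLength v ≠ ⊤ := scatteringLength_ne_top (by rwa [h2int])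
  have h8a : 8 * Real.pi * (scatteringLength v).toReal ≤ (∫⁻ x : Space, v ‖x‖).toReal := by
    have h := ENNReal.toReal_mono h2top (h2int ▸ four_pi_mul_scatteringLength_le v)
    rw [ENNReal.toReal_mul, ENNReal.toReal_mul, ENNReal.toReal_ofReal (by positivity),
      ENNReal.toReal_inv, ENNReal.toReal_ofNat] at h
    linarith
  -- the two inputs at accuracy `ε/4`
  have hε4 : 0 < ε / 4 := by positivity
  obtain ⟨ρ₁, hρ₁, H₁⟩ := hCT v hv hint (ε / 4) hε4
  obtain ⟨ρ₂, hρ₂, H₂⟩ := penalisedCondensation_lowerBound_eventually v hv ha_top hε4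
  refine ⟨min ρ₁ ρ₂, lt_min hρ₁ hρ₂, fun ρ hρ hρlt => ?_⟩
  filter_upwards [H₁ ρ hρ (hρlt.trans_le (min_le_left _ _)),
    H₂ ρ hρ (hρlt.trans_le (min_le_right _ _))] with n hn₁ hn₂
  obtain ⟨Φ, hΦE, hΦn⟩ := hn₁
  refine ⟨ENNReal.ofReal (ρ * (∫⁻ x : Space, v ‖x‖).toReal * ε / 4),
    ENNReal.ofReal_pos.mpr (by positivity), fun Ψ hΨ => ?_⟩
  -- the sandwich `2ργ (N - n₀Ψ) ≤ 4πaρ(1+ε/4)N + 2ργ (ε/4) N + δ - 4πaρ(1-ε/4)N`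
  have hsand := penalisedCondensation_sandwich (fun Ψ' => periodicEnergy v Ψ')
    (fun Ψ' => ((n + 2 : ℕ) : ℝ≥0∞) - condensateOccupation (n + 2) (sideLength ρ (n + 2)) Ψ'.ψ)
    hΨ (hn₂.trans (periodicGroundStateEnergy_le v Ψ)) ENNReal.ofReal_ne_top hΦE
    (tsub_le_iff_left.mpr hΦn)
  have h14 : 0 ≤ 1 - ε / 4 := by linarith
  have hN2 : (2 : ℝ) ≤ ((n + 2 : ℕ) : ℝ) := by exact_mod_cast Nat.le_add_left 2 n
  have hD : ((n + 2 : ℕ) : ℝ≥0∞) - condensateOccupation (n + 2) (sideLength ρ (n + 2)) Ψ.ψ ≤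
      ENNReal.ofReal (ε * ((n + 2 : ℕ) : ℝ)) :=
    penalisedCondensation_depletion_le (by positivity)
      (mul_nonneg (mul_nonneg (by positivity) h14) (by positivity)) (by positivity) (by positivity)
      (by positivity) hsand
      (penalisedCondensation_real_ineq hγ h8a hρ hε hN2)
  -- `N - n₀Ψ ≤ εN` gives `(1-ε)N ≤ n₀Ψ`
  have hN : ((n + 2 : ℕ) : ℝ≥0∞) ≤ condensateOccupation (n + 2) (sideLength ρ (n + 2)) Ψ.ψ +
      ENNReal.ofReal (ε * ((n + 2 : ℕ) : ℝ)) := tsub_le_iff_left.mp hD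
  calc ENNReal.ofReal ((1 - ε) * ((n + 2 : ℕ) : ℝ))
      = ENNReal.ofReal (((n + 2 : ℕ) : ℝ) - ε * ((n + 2 : ℕ) : ℝ)) := by congr 1; ring
    _ = ((n + 2 : ℕ) : ℝ≥0∞) - ENNReal.ofReal (ε * ((n + 2 : ℕ) : ℝ)) := by
        rw [ENNReal.ofReal_sub _ (by positivity), ENNReal.ofReal_natCast]
    _ ≤ _ := tsub_le_iff_right.mpr hN

end Summit.AtomisticToContinuum.BoseEinsteinCondensation.Theorems.BeliaevDeformationBound

end
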